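import Literature.AnabelianGeometry.SemiGraphs.StarOfLeavesGraph
import Literature.AnabelianGeometry.SemiGraphs.IwahoriMetabelianLeavesSlim
import Literature.AnabelianGeometry.SemiGraphs.TemperedEstrangedElevatedConstructors
import Literature.AnabelianGeometry.SemiGraphs.FreeProPTwoEstrangementByAbelianisation
import HarnessLib

/-!
# The CONCRETE rayless counter-carrier `𝒢⋆(p)`: the leaf-star of the free pro-`p` group of rank two with
# metabelian Iwahori leaves («RAYLESS-STAR·CIV-NEG», brick S3: instantiation and (H1)–(H3))

Mochizuki, *Semi-graphs of anabelioids*, Publ. RIMS **42** (2006), Def. 2.1 p. 22, Def. 2.4 (ii)/(iv) pp. 25–26,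
Thm. 3.7 p. 40 [cite: MochizukiSemiAnbd2006, Def 2.1 p.22].

abc-iut cell, layer L3, row «RAYLESS-STAR·CIV-NEG» (L3-lead β77 (2); seat abc-iut-L3-t8 gen 6; desk memo
`HOME/staging/L3/L3-t8/g6/VERTICAL-ESCAPE-RAYLESS-STAR-L3t8g6.md` §1).  HONEST FRAMING: towards a kernel erratum-class
NEGATIVE VALUE for the ∀-countable reading of [SemiAnbd] Thm 3.7 (iii) at a NEW carrier class (countable, rayless,
one vertex of infinite valence); print proves the FINITE-`𝔾` case (kernel p431007), the only case IUT consumes.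
This file DEFINES the object and proves its ELEMENTARY hypotheses; nothing of Thm 3.7 is asserted; no side taken
on [IUTchIII] Cor 3.12.

* `starOfLeaves_isTotallyEstranged_and_isTotallyAloof` — (H3) in BINDER form for every leaf-star of groups:
  infinitude of the branch groups, pairwise estrangement of the centre branch groups `range (up n)`
  (`m ≠ n` or a conjugator outside), malnormality of each leaf branch group `range (low n)`.
* `leafStarGroups p : Option ℕ → ProfiniteGrp` — centre `F̂₂⁽ᵖ⁾ = FreeProPRankTwo.Grp p`, leaf `n` the
  metabelian `Iw.Leaf n = ℤ_p ⋊ ⟨1 + p^{n+1}⟩‾` (bundled, so that the instance binders of `starOfLeaves` are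
  inferred uniformly — no instance is declared here).
* `metabelianLeafStar p` — `𝒢⋆(p)`: `starOfLeaves` with centre gluings `θα p n : 1 ↦ a·b^{pⁿ}` (branch groups
  `An p n = ⟨a·b^{pⁿ}⟩‾`, ACCUMULATING at `⟨a⟩‾`) and leaf gluings `Iw.lowHom n` (branch group the torus of the leaf).
* (H1)/(H2)/(H3): injective type, verticially slim, totally estranged & aloof — the centre CROSS terms
  `⟨a b^{pⁿ}⟩‾ ∩ g·⟨a b^{p^m}⟩‾·g⁻¹ = 1` (`m ≠ n`) by abc-iut's abelianisation engine
  (`inf_conj_topologicalClosure_zpowers_eq_bot_of_character`) after the SHEAR `(u, v) ↦ (u, v − pⁿu)` of `ℤ_p²`,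
  the self terms by the Nielsen-basis malnormality (`closure_zpowers_aMulPow_inf_conj_eq_bot'`), the leaf terms
  by brick S2 (`Iw.range_lowHom_inf_conj_eq_bot`); assembly `metabelianLeafStar_thm37Hypotheses` over the three
  remaining named inputs (Galois-countable, quasi-coherent, totally elevated — brick S4).
-/

noncomputable section

open scoped Pointwise
open Topology Multiplicative

namespace Literature.AnabelianGeometry.SemiGraphs

namespace ProfiniteSemiGraph

/-! ### (H3) for a leaf-star of groups, binder form -/

section Binder

variable (V : Option ℕ → Type) [∀ v, Group (V v)] [∀ v, TopologicalSpace (V v)]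
  [∀ v, IsTopologicalGroup (V v)] [∀ v, CompactSpace (V v)] [∀ v, TotallyDisconnectedSpace (V v)]
  (E : Type) [Group E] [TopologicalSpace E] [IsTopologicalGroup E] [CompactSpace E]
  [TotallyDisconnectedSpace E] (up : ℕ → (E →ₜ* V none)) (low : ∀ n : ℕ, E →ₜ* V (some n))

/-- **(H3) in binder form for a leaf-star of groups**: if all branch groups are infinite, the centre branch
groups `range (up n)` are pairwise estranged (`range (up n) ∩ g·range (up m)·g⁻¹ = 1` whenever `m ≠ n` or
`g ∉ range (up n)`) and every leaf branch group `range (low n)` is malnormal in its leaf group, then the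
leaf-star is totally estranged and totally aloof. [cite: MochizukiSemiAnbd2006, Def 2.4(iv) p.26] -/
theorem starOfLeaves_isTotallyEstranged_and_isTotallyAloof
    (hup_inf : ∀ n, ((up n).toMonoidHom.range : Set (V none)).Infinite)
    (hlow_inf : ∀ n, ((low n).toMonoidHom.range : Set (V (some n))).Infinite)
    (hup : ∀ (m n : ℕ) (g : V none), (m ≠ n ∨ g ∉ (up n).toMonoidHom.range) →
      (up n).toMonoidHom.range ⊓ ((up m).toMonoidHom.range).map (MulAut.conj g).toMonoidHom = ⊥)
    (hlow : ∀ (n : ℕ) (g : V (some n)), g ∉ (low n).toMonoidHom.range →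
      (low n).toMonoidHom.range ⊓ ((low n).toMonoidHom.range).map (MulAut.conj g).toMonoidHom = ⊥) :
    (starOfLeaves V E up low).IsTotallyEstranged ∧ (starOfLeaves V E up low).IsTotallyAloof := by
  refine (starOfLeaves V E up low).isTotallyEstranged_and_isTotallyAloof_of_forall_inf_conj_eq_bot ?_ ?_
  · rintro b v h
    cases v with
    | none =>
      obtain ⟨-, hB⟩ := starOfLeaves_branchSubgroup_none V E up low b h
      rw [hB]; exact hup_inf b.1
    | some n =>
      obtain ⟨-, hB⟩ := starOfLeaves_branchSubgroup_some V E up low b n h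
      rw [hB]; exact hlow_inf n
  · rintro v b h b' h' g hg
    cases v with
    | none =>
      obtain ⟨hb, hB⟩ := starOfLeaves_branchSubgroup_none V E up low b h
      obtain ⟨hb', hB'⟩ := starOfLeaves_branchSubgroup_none V E up low b' h'
      rw [hB] at hg ⊢
      rw [hB']
      refine hup b'.1 b.1 g ?_
      rcases hg with hne | hg
      · left
        intro heq
        apply hne
        rw [hb, hb', heq]
      · exact Or.inr hg
    | some n =>
      obtain ⟨hb, hB⟩ := starOfLeaves_branchSubgroup_some V E up low b n h
      obtain ⟨hb', hB'⟩ := starOfLeaves_branchSubgroup_some V E up low b' n h'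
      rw [hB] at hg ⊢
      rw [hB']
      rcases hg with hne | hg
      · exact absurd (hb'.trans hb.symm) hne
      · exact hlow n g hg

/-- (H3), estranged half. [cite: MochizukiSemiAnbd2006, Def 2.4(iv) p.26] -/
theorem starOfLeaves_isTotallyEstranged
    (hup_inf : ∀ n, ((up n).toMonoidHom.range : Set (V none)).Infinite)
    (hlow_inf : ∀ n, ((low n).toMonoidHom.range : Set (V (some n))).Infinite)
    (hup : ∀ (m n : ℕ) (g : V none), (m ≠ n ∨ g ∉ (up n).toMonoidHom.range) →
      (up n).toMonoidHom.range ⊓ ((up m).toMonoidHom.range).map (MulAut.conj g).toMonoidHom = ⊥)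
    (hlow : ∀ (n : ℕ) (g : V (some n)), g ∉ (low n).toMonoidHom.range →
      (low n).toMonoidHom.range ⊓ ((low n).toMonoidHom.range).map (MulAut.conj g).toMonoidHom = ⊥) :
    (starOfLeaves V E up low).IsTotallyEstranged :=
  (starOfLeaves_isTotallyEstranged_and_isTotallyAloof V E up low hup_inf hlow_inf hup hlow).1

end Binder

end ProfiniteSemiGraph

/-! ### The centre: pairwise estrangement of the accumulating branch groups `An p n = ⟨a·b^{pⁿ}⟩‾` -/

namespace FreeProPRankTwo

variable (p : ℕ) [hp : Fact p.Prime]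

/-- The shear `(u, v) ↦ (u, v − d·u)` of `ℤ_p × ℤ_p` (an additive automorphism moving the line of slope `d`
onto the axis). [cite: MochizukiSemiAnbd2006, Def 2.4(iv) p.26] -/
def shear (d : ℤ_[p]) : ℤ_[p] × ℤ_[p] →+ ℤ_[p] × ℤ_[p] :=
  (AddMonoidHom.fst ℤ_[p] ℤ_[p]).prod
    (AddMonoidHom.snd ℤ_[p] ℤ_[p] - (AddMonoidHom.mulLeft d).comp (AddMonoidHom.fst ℤ_[p] ℤ_[p]))

/-- The shear in coordinates. [cite: MochizukiSemiAnbd2006, Def 2.4(iv) p.26] -/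
@[simp] theorem shear_apply (d : ℤ_[p]) (v : ℤ_[p] × ℤ_[p]) : shear p d v = (v.1, v.2 - d * v.1) := rfl

/-- The shear is continuous. [cite: MochizukiSemiAnbd2006, Def 2.4(iv) p.26] -/
theorem continuous_shear (d : ℤ_[p]) : Continuous (shear p d) :=
  continuous_fst.prodMk (continuous_snd.sub (continuous_const.mul continuous_fst))

/-- The sheared abelianisation `ab_n := shear(pⁿ) ∘ ab : F̂₂⁽ᵖ⁾ → ℤ_p × ℤ_p`, under which the branch generator
`a·b^{pⁿ}` becomes `(1, 0)`. [cite: MochizukiSemiAnbd2006, Def 2.4(iv) p.26] -/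
def abShear (n : ℕ) : Grp p →* Multiplicative (ℤ_[p] × ℤ_[p]) :=
  (shear p ((p : ℤ_[p]) ^ n)).toMultiplicative.comp (ab p).toMonoidHom

/-- The sheared abelianisation is continuous. [cite: MochizukiSemiAnbd2006, Def 2.4(iv) p.26] -/
theorem continuous_abShear (n : ℕ) : Continuous (abShear p n) :=
  continuous_ofAdd.comp ((continuous_shear p _).comp (continuous_toAdd.comp (ab p).continuous))

/-- `ab_n (a·b^{p^m}) = (1, p^m − pⁿ)`. [cite: MochizukiSemiAnbd2006, Def 2.4(iv) p.26] -/
theorem abShear_a_mul_b_pow (n m : ℕ) :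
    (abShear p n (a p * b p ^ p ^ m)).toAdd = (1, (p : ℤ_[p]) ^ m - (p : ℤ_[p]) ^ n) := by
  change shear p ((p : ℤ_[p]) ^ n) ((ab p (a p * b p ^ p ^ m)).toAdd) = _
  rw [map_mul, map_pow, ab_a, ab_b, toAdd_mul, toAdd_pow, toAdd_ofAdd, toAdd_ofAdd, shear_apply]
  simp

/-- `ab_n (a·b^{pⁿ}) = (1, 0)`. [cite: MochizukiSemiAnbd2006, Def 2.4(iv) p.26] -/
theorem abShear_self (n : ℕ) : (abShear p n (a p * b p ^ p ^ n)).toAdd = (1, 0) := by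
  rw [abShear_a_mul_b_pow, sub_self]

/-- `θα p n 1 = a·b^{pⁿ}`. [cite: RibesZalesskii2010, §3.3] -/
theorem θα_ofAdd_one (n : ℕ) : θα p n (ofAdd 1) = a p * b p ^ p ^ n := by
  rw [θα_apply, α_ofAdd_one, θ_a]

/-- **Pairwise estrangement of the centre branch groups**: for `m ≠ n` and EVERY `g`,
`⟨a·b^{pⁿ}⟩‾ ∩ g·⟨a·b^{p^m}⟩‾·g⁻¹ = 1` (abelianisation after the shear of slope `pⁿ`: `ℤ_p` is a domain and
`p^m ≠ pⁿ`; injectivity on `⟨a·b^{pⁿ}⟩‾` from its `ℤ_p`-exponential `θα p n`).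
[cite: MochizukiSemiAnbd2006, Def 2.4(iv) p.26] -/
theorem An_inf_conj_An_eq_bot_of_ne {m n : ℕ} (hmn : m ≠ n) (g : ConjAct (Grp p)) :
    An p n ⊓ g • An p m = ⊥ := by
  have hd : (p : ℤ_[p]) ^ m - (p : ℤ_[p]) ^ n ≠ 0 := by
    intro h
    apply hmn
    have h' : (((p ^ m : ℕ) : ℤ_[p])) = ((p ^ n : ℕ) : ℤ_[p]) := by push_cast; exact sub_eq_zero.mp h
    exact Nat.pow_right_injective hp.out.two_le (Nat.cast_injective h')
  have hrange : (Subgroup.zpowers (a p * b p ^ p ^ n)).topologicalClosure ≤ (θα p n).toMonoidHom.range := by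
    rw [range_θα]; exact le_rfl
  have hinj := FreeProPTwo.PadicInt.eq_one_of_mem_topologicalClosure_zpowers_of_map_eq_one p (abShear p n)
    (continuous_abShear p n) (abShear_self p n) (θα p n).toMonoidHom (θα p n).continuous (θα_ofAdd_one p n)
    hrange
  exact FreeProPTwo.inf_conj_topologicalClosure_zpowers_eq_bot_of_character (abShear p n)
    (continuous_abShear p n) hd (abShear_self p n) (abShear_a_mul_b_pow p n m) hinj g

omit hp in
/-- **Self terms**: `⟨a·b^{pⁿ}⟩‾ ∩ x·⟨a·b^{pⁿ}⟩‾·x⁻¹ = 1` for `x ∉ ⟨a·b^{pⁿ}⟩‾` (malnormality along the Nielsen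
basis `{a·b^{pⁿ}, b}`, abc-iut-w6-d019's `closure_zpowers_aMulPow_inf_conj_eq_bot'`).
[cite: MochizukiSemiAnbd2006, Def 2.4(iv) p.26] -/
theorem An_inf_conj_An_eq_bot_of_not_mem (n : ℕ) {x : Grp p} (hx : x ∉ An p n) :
    An p n ⊓ ConjAct.toConjAct x • An p n = ⊥ := by
  have h := closure_zpowers_aMulPow_inf_conj_eq_bot' (isProSigmaCompletion_ι p) (p ^ n) (x := x)
  have hgen : ι p (FreeGroup.of 0 * FreeGroup.of 1 ^ p ^ n) = a p * b p ^ p ^ n := by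
    rw [map_mul, map_pow]; rfl
  rw [hgen] at h
  exact h hx

/-- The two cases together, in the `map (MulAut.conj g)` spelling of `IsEstrangedEdge`, for the ranges of the
centre gluings `θα p n`. [cite: MochizukiSemiAnbd2006, Def 2.4(iv) p.26] -/
theorem range_θα_inf_conj_eq_bot (m n : ℕ) (g : Grp p)
    (h : m ≠ n ∨ g ∉ (θα p n).toMonoidHom.range) :
    (θα p n).toMonoidHom.range ⊓ ((θα p m).toMonoidHom.range).map (MulAut.conj g).toMonoidHom = ⊥ := by
  rw [range_θα, range_θα, ProfiniteSemiGraph.map_conj_eq_toConjAct_smul]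
  rcases h with hmn | hg
  · exact An_inf_conj_An_eq_bot_of_ne p hmn (ConjAct.toConjAct g)
  · rw [range_θα] at hg
    by_cases hmn : m = n
    · subst hmn
      exact An_inf_conj_An_eq_bot_of_not_mem p m hg
    · exact An_inf_conj_An_eq_bot_of_ne p hmn (ConjAct.toConjAct g)

end FreeProPRankTwo

/-! ### `𝒢⋆(p)`: the concrete leaf-star -/

namespace ProfiniteSemiGraph

variable (p : ℕ) [hp : Fact p.Prime]

/-- The vertex groups of `𝒢⋆(p)`, bundled: the free pro-`p` group of rank two at the centre, the metabelian
leaf `Iw.Leaf n` at the leaf `n`. [cite: MochizukiSemiAnbd2006, Def 2.1 p.22] -/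
def leafStarGroups : Option ℕ → ProfiniteGrp.{0} :=
  fun v => v.elim (FreeProPRankTwo.Grp p) fun n => ProfiniteGrp.of (Iw.Leaf (p := p) n)

/-- The centre group is `F̂₂⁽ᵖ⁾`. [cite: MochizukiSemiAnbd2006, Def 2.1 p.22] -/
@[simp] theorem leafStarGroups_none : leafStarGroups p none = FreeProPRankTwo.Grp p := rfl

/-- The leaf group at `n` is `Iw.Leaf n`. [cite: MochizukiSemiAnbd2006, Def 2.1 p.22] -/
@[simp] theorem leafStarGroups_some (n : ℕ) :
    leafStarGroups p (some n) = ProfiniteGrp.of (Iw.Leaf (p := p) n) := rfl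

/-- **`𝒢⋆(p)`** — the rayless counter-carrier: the leaf-star with centre `F̂₂⁽ᵖ⁾`, centre gluings
`θα p n : 1 ↦ a·b^{pⁿ}` (branch groups `⟨a·b^{pⁿ}⟩‾`, accumulating at `⟨a⟩‾`), leaves `ℤ_p ⋊ ⟨1+p^{n+1}⟩‾` glued
along their tori by `Iw.lowHom n`. [cite: MochizukiSemiAnbd2006, Def 2.1 p.22] -/
def metabelianLeafStar : ProfiniteSemiGraph.{0} :=
  starOfLeaves (fun v => leafStarGroups p v) (Multiplicative ℤ_[p]) (fun n => FreeProPRankTwo.θα p n)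
    (fun n => Iw.lowHom (p := p) n)

/-- `𝒢⋆(p)` unfolds to `starOfLeaves`. [cite: MochizukiSemiAnbd2006, Def 2.1 p.22] -/
theorem metabelianLeafStar_eq : metabelianLeafStar p =
    starOfLeaves (fun v => leafStarGroups p v) (Multiplicative ℤ_[p]) (fun n => FreeProPRankTwo.θα p n)
      (fun n => Iw.lowHom (p := p) n) := rfl

/-- The underlying semi-graph of `𝒢⋆(p)` is the leaf-star. [cite: MochizukiSemiAnbd2006, §1 p.11] -/
@[simp] theorem metabelianLeafStar_graph : (metabelianLeafStar p).graph = SemiGraph.leafStar := rfl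

/-- `𝒢⋆(p)` is of injective type (`θα p n` and `Iw.lowHom n` are injective).
[cite: MochizukiSemiAnbd2006, Def 2.1 p.22] -/
theorem metabelianLeafStar_isOfInjectiveType : (metabelianLeafStar p).IsOfInjectiveType :=
  starOfLeaves_isOfInjectiveType _ _ _ _ (fun n => FreeProPRankTwo.θα_injective p n)
    (fun n => Iw.lowHom_injective n)

/-- `𝒢⋆(p)` is verticially slim (free pro-`p` of rank two: abc-iut-w6-d019; the leaves: brick S2).
[cite: MochizukiSemiAnbd2006, Def 2.4 (ii) p.25] -/
theorem metabelianLeafStar_isVerticiallySlim : (metabelianLeafStar p).IsVerticiallySlim := by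
  refine starOfLeaves_isVerticiallySlim _ _ _ _ fun v => ?_
  cases v with
  | none => exact FreeProPRankTwo.isSlimGroup p
  | some n => exact Iw.isSlimGroup_leaf n

/-- **(H3) for `𝒢⋆(p)`**: totally estranged and totally aloof. [cite: MochizukiSemiAnbd2006, Def 2.4(iv) p.26] -/
theorem metabelianLeafStar_isTotallyEstranged_and_isTotallyAloof :
    (metabelianLeafStar p).IsTotallyEstranged ∧ (metabelianLeafStar p).IsTotallyAloof := by
  refine starOfLeaves_isTotallyEstranged_and_isTotallyAloof _ _ _ _ ?_ ?_ ?_ ?_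
  · intro n
    change ((FreeProPRankTwo.θα p n).toMonoidHom.range : Set (FreeProPRankTwo.Grp p)).Infinite
    rw [FreeProPRankTwo.range_θα]
    exact FreeProPRankTwo.infinite_An p n
  · intro n
    exact Iw.infinite_range_lowHom n
  · intro m n g h
    exact FreeProPRankTwo.range_θα_inf_conj_eq_bot p m n g h
  · intro n g hg
    exact Iw.range_lowHom_inf_conj_eq_bot g hg

/-- (H3), estranged half. [cite: MochizukiSemiAnbd2006, Def 2.4(iv) p.26] -/
theorem metabelianLeafStar_isTotallyEstranged : (metabelianLeafStar p).IsTotallyEstranged :=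
  (metabelianLeafStar_isTotallyEstranged_and_isTotallyAloof p).1

/-- (H3), aloof half. [cite: MochizukiSemiAnbd2006, Def 2.4(iv) p.26] -/
theorem metabelianLeafStar_isTotallyAloof : (metabelianLeafStar p).IsTotallyAloof :=
  (metabelianLeafStar_isTotallyEstranged_and_isTotallyAloof p).2

/-- `𝒢⋆(p)` is connected, countable, has a vertex, and is a graph of anabelioids; its underlying semi-graph is
NOT locally finite. [cite: MochizukiSemiAnbd2006, Prop 3.6 p.38] -/
theorem metabelianLeafStar_isConnected_isCountable_hasVertex :
    (metabelianLeafStar p).IsConnected ∧ (metabelianLeafStar p).IsCountable ∧ (metabelianLeafStar p).HasVertex ∧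
      (metabelianLeafStar p).IsGraph ∧ ¬ (metabelianLeafStar p).graph.IsLocallyFinite :=
  ⟨starOfLeaves_isConnected _ _ _ _, starOfLeaves_isCountable _ _ _ _, starOfLeaves_hasVertex _ _ _ _,
    starOfLeaves_isGraph _ _ _ _, starOfLeaves_not_isLocallyFinite _ _ _ _⟩

/-- **`Thm37Hypotheses 𝒢⋆(p)` assembled** from this file's (H1)–(H3) and the three remaining bundle fields
taken as NAMED INPUTS (brick S4: Galois-countable, quasi-coherent, totally elevated).
[cite: MochizukiSemiAnbd2006, Thm 3.7 p.40] -/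
theorem metabelianLeafStar_thm37Hypotheses (hGC : (metabelianLeafStar p).IsGaloisCountable)
    (hQC : (metabelianLeafStar p).IsQuasiCoherent) (hTE : (metabelianLeafStar p).IsTotallyElevated) :
    (metabelianLeafStar p).Thm37Hypotheses :=
  starOfLeaves_thm37Hypotheses _ _ _ _ (fun n => FreeProPRankTwo.θα_injective p n)
    (fun n => Iw.lowHom_injective n)
    (fun v => by
      cases v with
      | none => exact FreeProPRankTwo.isSlimGroup p
      | some n => exact Iw.isSlimGroup_leaf n)
    hGC hQC hTE (metabelianLeafStar_isTotallyEstranged p)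

end ProfiniteSemiGraph

end Literature.AnabelianGeometry.SemiGraphs

end
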